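import Mathlib
import Summits.QuantumAdvantage.AdviceFreeQNC0.OddPrimeStatements
import Summits.QuantumAdvantage.AdviceFreeQNC0.WalkFailFloor
import Summits.QuantumAdvantage.QuantumAdvantage.Theorems.AbsorptionDialF

set_option linter.dupNamespace false

/-!
# AbsorptionDial (G) — the general transfer theorem `N > 2^d`: every constant rung below `log₂ p` (cell decomp-qadv, lens 4, g14 rev 6)

Prop-definition-free continuation of `AbsorptionDialF` (imports it; lands AFTER it; supports of the degree axis of
`X = NoPerfectPolyOdd`, item stmt-QuantumAdvantage-28487 of route-QuantumAdvantage-AbsorptionDial, and of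
stmt-QuantumAdvantage-26994 ≡ 26767):

* **`moeb_shift`** — the FACE FORMULA: for `A` disjoint from `T`, the Möbius transform of `U ↦ v (A ∪ U)` at `T` is
  `Σ_{V ⊆ A} v̂ (V ∪ T)` (insertion induction from `moeb_insert`).
* **`moeb_bounds`** — the Möbius transform of a `[0,1]`-valued set function at a nonempty `T` lies in `[−2^{|T|−1}, 2^{|T|−1}]`.
* **`cZ_eq_zero_of_dvd_of_pow_lt`** — THE GENERAL TRANSFER THEOREM: if an integer `N > 2^d` divides `cZ f S` for all
  `|S| > d` then all these coefficients VANISH (strong induction on `S`; `c_S` is the top Möbius coefficient of a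
  `(d+1)`-dimensional face function, an alternating sum of `2^{d+1}` bits, so `|c_S| ≤ 2^d < N`).  It subsumes the
  degree-one (`junta_one_of_hasDegF_one`, part E) and degree-two (`cZ_eq_zero_of_dvd`, part F) transfers.
* `cZ_eq_zero_of_hasDegF`, **`hasDeg_of_hasDegF`** (prime `p > 2^d`: `𝔽_p`-degree ≤ d ⟹ `𝔽₂`-degree ≤ d),
  `hasDegF_transfer`; **`deg_fail_floor`** — for a prime `p > 2^d`, `n ≥ 2d+3`, every charge: a strategy vector of
  `𝔽_p`-cut-degree `≤ d` loses the u-walk game on `≥ 2^{n−(2d+3)}` inputs (`WalkFailFloor.ringWinU_fail_floor d` transferred).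
* SHARPNESS (kernel `decide` examples, no `native_decide`): `|c_top| = 2^d` for parity of `d+1` bits (`d = 1,2,3`), and
  Boolean functions of `𝔽₃`-degree 2 / `𝔽₅`-degree 3 / `𝔽₇`-degree 3 whose `𝔽₂`-degree is `3 / 4 / 4`: TRANSFER(d,p) fails at
  every prime `p ≤ 2^d` for `d ≤ 3`, so «`𝔽_p`-degree ≤ d ⟹ `𝔽₂`-degree ≤ d for Boolean functions» holds iff `p > 2^d` (`d ≤ 3`).

0 sorry · no new axioms · no instance / notation / native_decide.
-/

open Finset
open Literature.Computability.MetaComplexity Literature.Computability.MetaComplexity.Smolensky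
open Summit.QuantumAdvantage.AdviceFreeQNC0

namespace Summit.QuantumAdvantage.QuantumAdvantage.Theorems.AbsorptionDial

/-! ## The GENERAL transfer theorem: `N > 2^d`

The degree-two theorem is the case `d = 2` of a general and equally elementary statement with a SHORTER proof:
if an integer `N > 2^d` divides every Möbius coefficient `c_S(f)` with `|S| > d` of a Boolean function `f`,
then all those coefficients vanish.  Proof: for `|S| > d` pick `R ⊆ S` with `|R| = d + 1`, `A = S ∖ R`;
the FACE FORMULA `moeb_shift` expresses the top Möbius coefficient of the face function `U ↦ f(1_{A ∪ U})`
(`U ⊆ R`) as `Σ_{V ⊆ A} c_{V ∪ R}(f)`; by induction every term with `V ≠ A` vanishes (`d < |V ∪ R| < |S|`),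
so `c_S(f)` IS that top coefficient — an alternating sum of `2^{d+1}` values in `{0,1}`, half with each sign,
hence `|c_S| ≤ 2^d < N`.  The bound `2^d` is attained by the parity of `d + 1` bits (`c_top = ±2^d`), and on
`d + 1` bits every value `c_top ∈ [−2^d, 2^d]` occurs, so the hypothesis `N > 2^d` is SHARP for every `N`;
for primes: TRANSFER(d, p) («`𝔽_p`-degree `≤ d` ⟹ `𝔽₂`-degree `≤ d` for Boolean functions») holds iff `p > 2^d`
(kernel-certified below for `d ≤ 3`: the failures at `(d,p) = (1,2), (2,3), (3,5), (3,7)` by `decide`). -/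

section Transfer

variable {n : ℕ}

/-- **face / shift formula**: the Möbius transform of the shifted set function `U ↦ v (A ∪ U)` at a set `T`
disjoint from `A` is `Σ_{V ⊆ A} v̂ (V ∪ T)`. -/
theorem moeb_shift {α : Type*} [DecidableEq α] {R : Type*} [CommRing R] (v : Finset α → R)
    {A T : Finset α} (h : Disjoint A T) :
    moeb (fun U => v (A ∪ U)) T = ∑ V ∈ A.powerset, moeb v (V ∪ T) := by
  induction A using Finset.induction_on generalizing v with
  | empty => simp
  | insert a A ha ih =>
    have haT : a ∉ T := fun h' => Finset.disjoint_left.1 h (Finset.mem_insert_self a A) h'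
    have hAT : Disjoint A T := Finset.disjoint_of_subset_left (Finset.subset_insert a A) h
    have e1 : (fun U => v (insert a A ∪ U)) = fun U => (fun X => v (insert a X)) (A ∪ U) := by
      funext U; simp [Finset.insert_union]
    rw [Finset.sum_powerset_insert ha, e1, ih (fun X => v (insert a X)) hAT, ← Finset.sum_add_distrib]
    refine Finset.sum_congr rfl fun V hV => ?_
    have haV : a ∉ V ∪ T := by
      rw [Finset.mem_union, not_or]
      exact ⟨fun h' => ha (Finset.mem_powerset.1 hV h'), haT⟩
    rw [Finset.insert_union, moeb_insert v haV]
    ring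

/-- **signed-sum bound**: the Möbius transform of a `[0,1]`-valued set function at a nonempty set `T` lies in
`[−2^{|T|−1}, 2^{|T|−1}]` (half of the `2^{|T|}` signs are `+`, half `−`). -/
theorem moeb_bounds {α : Type*} [DecidableEq α] (v : Finset α → ℤ) (h0 : ∀ U, 0 ≤ v U) (h1 : ∀ U, v U ≤ 1)
    {T : Finset α} (hT : T.Nonempty) :
    -(2 : ℤ) ^ (T.card - 1) ≤ moeb v T ∧ moeb v T ≤ (2 : ℤ) ^ (T.card - 1) := by
  have hs : ∑ U ∈ T.powerset, (-1 : ℤ) ^ (T.card - U.card) = 0 := by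
    have h := moeb_subsetIndicator (R := ℤ) (∅ : Finset α) T
    simp only [Finset.empty_subset, if_true, hT.ne_empty, if_false] at h
    simpa [moeb] using h
  have hc : ∑ U ∈ T.powerset, (1 : ℤ) = 2 ^ T.card := by simp [Finset.card_powerset]
  have hup : 2 * moeb v T ≤ 2 ^ T.card := by
    have key : ∀ U ∈ T.powerset,
        2 * ((-1 : ℤ) ^ (T.card - U.card) * v U) ≤ 1 + (-1 : ℤ) ^ (T.card - U.card) := by
      intro U _
      rcases neg_one_pow_eq_or ℤ (T.card - U.card) with h | h <;> rw [h] <;> nlinarith [h0 U, h1 U]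
    calc 2 * moeb v T = ∑ U ∈ T.powerset, 2 * ((-1 : ℤ) ^ (T.card - U.card) * v U) := by
          rw [moeb, Finset.mul_sum]
      _ ≤ ∑ U ∈ T.powerset, (1 + (-1 : ℤ) ^ (T.card - U.card)) := Finset.sum_le_sum key
      _ = 2 ^ T.card := by rw [Finset.sum_add_distrib, hs, add_zero, hc]
  have hlo : -(2 : ℤ) ^ T.card ≤ 2 * moeb v T := by
    have key : ∀ U ∈ T.powerset,
        (-1 : ℤ) ^ (T.card - U.card) - 1 ≤ 2 * ((-1 : ℤ) ^ (T.card - U.card) * v U) := by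
      intro U _
      rcases neg_one_pow_eq_or ℤ (T.card - U.card) with h | h <;> rw [h] <;> nlinarith [h0 U, h1 U]
    calc -(2 : ℤ) ^ T.card = ∑ U ∈ T.powerset, ((-1 : ℤ) ^ (T.card - U.card) - 1) := by
          rw [Finset.sum_sub_distrib, hs, hc, zero_sub]
      _ ≤ ∑ U ∈ T.powerset, 2 * ((-1 : ℤ) ^ (T.card - U.card) * v U) := Finset.sum_le_sum key
      _ = 2 * moeb v T := by rw [moeb, Finset.mul_sum]
  have hpow : (2 : ℤ) ^ T.card = 2 * 2 ^ (T.card - 1) := by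
    rw [← pow_succ']; congr 1; have := hT.card_pos; omega
  constructor <;> linarith

/-- **THE GENERAL TRANSFER THEOREM.**  For a Boolean `f` on the `n`-cube, `d : ℕ` and an integer `N > 2^d`:
if `N ∣ c_S(f)` for every `|S| > d`, then `c_S(f) = 0` for every `|S| > d`. -/
theorem cZ_eq_zero_of_dvd_of_pow_lt (f : (Fin n → Bool) → Bool) (d : ℕ) (N : ℤ) (hN : (2 : ℤ) ^ d < N)
    (hdiv : ∀ S : Finset (Fin n), d < S.card → N ∣ cZ f S) :
    ∀ S : Finset (Fin n), d < S.card → cZ f S = 0 := by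
  intro S
  induction S using Finset.strongInduction with
  | H S ih =>
  intro hS
  obtain ⟨R, hRS, hRc⟩ := Finset.exists_subset_card_eq (show d + 1 ≤ S.card by omega)
  set A := S \ R with hA
  have hAR : Disjoint A R := Finset.sdiff_disjoint
  have hAuR : A ∪ R = S := Finset.sdiff_union_of_subset hRS
  -- every proper term of the face formula vanishes by induction
  have hsum : ∑ V ∈ A.powerset, moeb (fv f) (V ∪ R) = cZ f S := by
    rw [← Finset.add_sum_erase _ _ (Finset.mem_powerset_self A), hAuR]
    have hz : ∑ V ∈ A.powerset.erase A, moeb (fv f) (V ∪ R) = 0 := by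
      refine Finset.sum_eq_zero fun V hV => ?_
      have hVne : V ≠ A := (Finset.mem_erase.1 hV).1
      have hVA : V ⊆ A := Finset.mem_powerset.1 (Finset.mem_erase.1 hV).2
      have hlt : V ∪ R ⊂ S := by
        refine Finset.ssubset_iff_subset_ne.2 ⟨?_, fun hEq => hVne (Finset.Subset.antisymm hVA fun x hx => ?_)⟩
        · rw [← hAuR]; exact Finset.union_subset_union hVA le_rfl
        · have hx' : x ∈ V ∪ R := by rw [hEq, ← hAuR]; exact Finset.mem_union_left _ hx
          rcases Finset.mem_union.1 hx' with h1 | h1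
          · exact h1
          · exact absurd h1 (Finset.disjoint_left.1 hAR hx)
      have hcard : d < (V ∪ R).card := by
        rw [Finset.card_union_of_disjoint (Finset.disjoint_of_subset_left hVA hAR)]; omega
      exact ih _ hlt hcard
    rw [hz, add_zero]; rfl
  -- so `c_S` is the top Möbius coefficient of the face function `U ↦ f(1_{A ∪ U})` on `R`
  have hface : cZ f S = moeb (fun U => fv f (A ∪ U)) R := by rw [moeb_shift (fv f) hAR, hsum]
  have hRne : R.Nonempty := Finset.card_pos.1 (by omega)
  have hb := moeb_bounds (fun U => fv f (A ∪ U)) (fun U => fv_nonneg f _) (fun U => fv_le_one f _) hRne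
  rw [hRc, Nat.add_sub_cancel, ← hface] at hb
  exact Int.eq_zero_of_dvd_of_natAbs_lt_natAbs (hdiv S hS) (by omega)

/-- for a prime `p > 2^d`, `𝔽_p`-degree `≤ d` kills every integer coefficient above degree `d` … -/
theorem cZ_eq_zero_of_hasDegF {p : ℕ} [Fact p.Prime] {d : ℕ} (hp : 2 ^ d < p)
    {f : (Fin n → Bool) → Bool} (hf : HasDegF p f d) :
    ∀ S : Finset (Fin n), d < S.card → cZ f S = 0 :=
  cZ_eq_zero_of_dvd_of_pow_lt f d p (by exact_mod_cast hp) ((hasDegF_iff_dvd_cZ f d).1 hf)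

/-- … hence **transfer**: `HasDegF p f d → HasDeg f d` whenever `p > 2^d` (for `d = 1`: `p ≥ 3`; `d = 2`:
`p ≥ 5`; `d = 3`: `p ≥ 11`; …), -/
theorem hasDeg_of_hasDegF {p : ℕ} [Fact p.Prime] {d : ℕ} (hp : 2 ^ d < p)
    {f : (Fin n → Bool) → Bool} (hf : HasDegF p f d) : HasDeg f d :=
  hasDeg_of_cZ_eq_zero (cZ_eq_zero_of_hasDegF hp hf)

/-- and to every other prime field. -/
theorem hasDegF_transfer {p q : ℕ} [Fact p.Prime] [Fact q.Prime] {d : ℕ} (hp : 2 ^ d < p)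
    {f : (Fin n → Bool) → Bool} (hf : HasDegF p f d) : HasDegF q f d :=
  (hasDegF_iff_dvd_cZ f d).2 fun S hS => by simp [cZ_eq_zero_of_hasDegF hp hf S hS]

end Transfer

/-- **the general fail floor**: for a prime `p > 2^d` and `n ≥ 2d + 3`, every strategy vector of
`𝔽_p`-cut-degree `≤ d` loses the u-walk game on at least `2^{n−(2d+3)}` inputs, for every charge. -/
theorem deg_fail_floor {p : ℕ} [Fact p.Prime] {d : ℕ} (hp : 2 ^ d < p) {n : ℕ} (hn : 2 * d + 3 ≤ n)
    (c : ℕ) (y : Fin (n + 1) → (Fin n → Bool) → Bool) (hy : ∀ g, HasDegF p (y g) d) :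
    2 ^ (n - (2 * d + 3)) ≤ (Finset.univ.filter fun u : Fin n → Bool => ringWinU c y u = false).card := by
  simpa using ringWinU_fail_floor d hn c y fun g => hasDeg_of_hasDegF hp (hy g)

/-! ### Sharpness in the kernel: the four failures of TRANSFER(d, p) with `p ≤ 2^d`, `d ≤ 3` -/

section Sharp

/-- `d = 1`, `N = 2`: XOR of two bits has `c_top = −2`. -/
example : cZ (fun x : Fin 2 → Bool => xor (x 0) (x 1)) Finset.univ = -2 := by decide

/-- `d = 2`, `p = 3`: `[x₀+x₁+x₂ ≡ 2 (mod 3)] = e₂ − 3e₃` has `𝔽₃`-degree `2` and `c_top = −3`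
(so `𝔽₂`- and `𝔽₅`-degree `3`). -/
example : HasDegF 3 (fun x : Fin 3 → Bool =>
      decide (((if x 0 then 1 else 0) + (if x 1 then 1 else 0) + (if x 2 then 1 else 0)) % 3 = 2)) 2 ∧
    ¬ HasDeg (fun x : Fin 3 → Bool =>
      decide (((if x 0 then 1 else 0) + (if x 1 then 1 else 0) + (if x 2 then 1 else 0)) % 3 = 2)) 2 := by
  rw [hasDegF_iff_dvd_cZ, hasDeg_iff_dvd_cZ]; decide

/-- `d = 2`, `N = 4`: parity of three bits, `c_top = 4`. -/
example : cZ (fun x : Fin 3 → Bool => xor (xor (x 0) (x 1)) (x 2)) Finset.univ = 4 := by decide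

/-- `d = 3`, `p = 5`: «even weight, or weight one outside the last bit» on four bits has `c_top = 5`:
`𝔽₅`-degree `3`, `𝔽₂`-degree `4`. -/
example [Fact (Nat.Prime 5)] :
    HasDegF 5 (fun x : Fin 4 → Bool =>
      let w := (if x 0 then 1 else 0) + (if x 1 then 1 else 0) + (if x 2 then 1 else 0) + (if x 3 then 1 else 0)
      decide (w % 2 = 0) || (decide (w = 1) && !x 3)) 3 ∧
    ¬ HasDeg (fun x : Fin 4 → Bool =>
      let w := (if x 0 then 1 else 0) + (if x 1 then 1 else 0) + (if x 2 then 1 else 0) + (if x 3 then 1 else 0)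
      decide (w % 2 = 0) || (decide (w = 1) && !x 3)) 3 := by
  rw [hasDegF_iff_dvd_cZ, hasDeg_iff_dvd_cZ]; decide

/-- `d = 3`, `p = 7`: «even weight, or `x = 1000`» on four bits has `c_top = 7`: `𝔽₇`-degree `3`,
`𝔽₂`-degree `4`. -/
example [Fact (Nat.Prime 7)] :
    HasDegF 7 (fun x : Fin 4 → Bool =>
      let w := (if x 0 then 1 else 0) + (if x 1 then 1 else 0) + (if x 2 then 1 else 0) + (if x 3 then 1 else 0)
      decide (w % 2 = 0) || (x 0 && !x 1 && !x 2 && !x 3)) 3 ∧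
    ¬ HasDeg (fun x : Fin 4 → Bool =>
      let w := (if x 0 then 1 else 0) + (if x 1 then 1 else 0) + (if x 2 then 1 else 0) + (if x 3 then 1 else 0)
      decide (w % 2 = 0) || (x 0 && !x 1 && !x 2 && !x 3)) 3 := by
  rw [hasDegF_iff_dvd_cZ, hasDeg_iff_dvd_cZ]; decide

/-- `d = 3`, `N = 8`: parity of four bits, `c_top = −8`. -/
example : cZ (fun x : Fin 4 → Bool => xor (xor (xor (x 0) (x 1)) (x 2)) (x 3)) Finset.univ = -8 := by decide

end Sharp

end Summit.QuantumAdvantage.QuantumAdvantage.Theorems.AbsorptionDial
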